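import Summits.BirchSwinnertonDyer.Rank1Residual.Supersingular.X7ToricPeriodUnitConsumer
import Summits.BirchSwinnertonDyer.Rank1Residual.X11b.BDPRouteUpperLinksInert
import Summits.BirchSwinnertonDyer.Rank1Residual.X11b.BDPRouteUpperLinksInertTwo
import HarnessLib

/-!
# The Tamagawa inequality at the inert primes, `Σ_{ℓ∣N⁻} t_E(ℓ) ≤ ord_p ∏c(E) + ord_p ∏c(E^{(d_K)})`,
# and the consumer of `X7.ToricPeriodUnitAt` WITHOUT the hypothesis `p ∤ ∏c(E)`
# (cell `bsd-ssimc`, seat `bsd-ssimc-lev` gen 3, item (I3), part 3)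

PARTITION (cell bsd-ssimc): X7 (A7) r0 × p ≥ 5 × Surj — types-the-object-of; closes NONE. THEOREMS ONLY.

`X7ToricPeriodUnitConsumer.lean` closes `BSD(E,p) ∧ BSD(Wd,p)` from the (A3) data and two upper halves
under `p ∤ ∏c(E)` (plus the data's `ramified`, `tamagawa_twist`), because its exact identity
`ord q + ord qd + ord ∏c(E) + ord ∏c(Wd) = ord #Ш(E) + ord #Ш(Wd) + Σ_{ℓ∣N⁻} t_E(ℓ) + 2 ord tors` needs
the Tamagawa side to be no larger than the `N⁻` side. The opposite inequality is a THEOREM of Tate's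
algorithm and is what actually suffices: at an inert multiplicative `ℓ` exactly one of `E ⊗ ℚ_ℓ`,
`E^{(d_K)} ⊗ ℚ_ℓ` is split (the unramified quadratic twist exchanges split and non-split), and the
split one has `c_ℓ = ord_ℓ Δ_min(E)` (Kodaira–Néron; `ord_ℓ Δ_min` is twist-invariant for an `ℓ`-unit),
so `t_E(ℓ) = ord_p(ord_ℓ Δ_min E) ≤ ord_p c_ℓ(E) + ord_p c_ℓ(Wd)`; summing over `ℓ ∣ N⁻` inside the
product over all bad places gives `Σ_{ℓ∣N⁻} t_E(ℓ) ≤ ord_p ∏c(E) + ord_p ∏c(Wd)`. The tree's X11b lane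
proved the `≤`-companion (`X11b.padicValNat_localTamagawaNumber_add_twist_le_of_inert`, whose proof we
follow line by line; `X11b.twist_two_of_mod_eight` at `ℓ = 2`). Consequence
(`X7.bsdp_and_bsdp_twist_of_toricPeriodUnitData_of_inert`): with the two UPPER halves, the exact
identity forces `ord q = ord #Ш(E)`, `ord qd = ord #Ш(Wd)` AND `ord_p ∏c(E)∏c(Wd) = Σ t_E(ℓ)` — no
Tamagawa hypothesis on `E`; the inert primes are supplied as «odd with `(d_K/ℓ) = −1`, or `2` with
`d_K ≡ 5 (mod 8)`, and multiplicative» (decidable per pair; class-wide = `ℓ ∣ N⁻`).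

References: [SilvermanATAEC1994] Cor. IV.9.2(d); [SilvermanAEC2009] VII.5 Prop. 5.1, X.5;
[JetchevSkinnerWan2017] §7.3.1 (eq:tamK), §7.4.2; [Kim2024] Thm. 5.23; [Miller2011LMS] Def. 1.1.
-/

noncomputable section

open scoped Classical

open WeierstrassCurve NumberField IsDedekindDomain Literature.NumberTheory.EllipticCurves
  Rat.HeightOneSpectrum
  Literature.NumberTheory.EllipticCurves.ModularForms
  Literature.NumberTheory.EllipticCurves.Rank1Residual
  Literature.NumberTheory.EllipticCurves.Rank1Residual.Typed
  Literature.NumberTheory.EllipticCurves.CaiShuTian2014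
  Literature.NumberTheory.EllipticCurves.Kim2024
  Literature.NumberTheory.Automorphic

namespace Summit.BirchSwinnertonDyer.Rank1Residual.Supersingular

/-! ### One inert multiplicative prime -/

/-- **At an odd inert multiplicative prime, `ord_p(ord_ℓ Δ_min E) ≤ ord_p c_ℓ(E) + ord_p c_ℓ(E^{(d_K)})`.**
`W/ℚ` globally minimal, multiplicative at the odd prime `ℓ` with `(d_K/ℓ) = −1`, `Wd` a globally minimal
model of `E^{(d_K)}`, `p` any prime: `d_K` is a non-square unit of `ℤ_ℓ`, so exactly one of `E ⊗ ℚ_ℓ`,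
`E^{(d_K)} ⊗ ℚ_ℓ` is SPLIT multiplicative (`hasSplitMultiplicativeReduction_quadraticTwist_iff`), and the
split one has `c_ℓ = ord_ℓ Δ_min(E)` (`X11b.localTamagawaNumber_eq_padicValInt_of_split`,
`X11b.padicValInt_minimalDiscriminantInt_twist_eq_of_jacobiSym`). The `≥`-companion of
`X11b.padicValNat_localTamagawaNumber_add_twist_le_of_inert` (same proof, other end).
[cite: SilvermanATAEC1994, Cor. IV.9.2(d) with (b) (PDF p. 340)] [cite: SilvermanAEC2009, VII.5 Prop. 5.1(b) and VII.1 Prop. 1.3(b)] -/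
theorem padicValNat_ordDisc_le_localTamagawaNumber_add_twist_of_inert (W : WeierstrassCurve ℚ)
    [W.IsElliptic] [W.IsGloballyMinimal] (K : Type) [Field K] [NumberField K]
    {Wd : WeierstrassCurve ℚ} [Wd.IsElliptic] [Wd.IsGloballyMinimal] (Cd : VariableChange ℚ)
    (hWd : Cd • W.quadraticTwist (NumberField.discr K : ℚ) = Wd)
    (ℓ : ℕ) [Fact ℓ.Prime] (hℓ2 : ℓ ≠ 2) (hJ : jacobiSym (NumberField.discr K) ℓ = -1)
    (p : ℕ) [Fact p.Prime] (hmult : Mult W ℓ) :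
    padicValNat p (padicValInt ℓ W.minimalDiscriminantInt) ≤
      padicValNat p ((W.baseChange ℚ_[ℓ]).localTamagawaNumber ℤ_[ℓ]) +
        padicValNat p ((Wd.baseChange ℚ_[ℓ]).localTamagawaNumber ℤ_[ℓ]) := by
  set d : ℤ := NumberField.discr K with hd_def
  have hℓd : ¬ (ℓ : ℤ) ∣ d := X11b.not_dvd_of_jacobiSym_eq_neg_one hJ
  have hd0 : d ≠ 0 := by rw [hd_def]; exact NumberField.discr_ne_zero K
  have hD0 : (d : ℚ) ≠ 0 := by exact_mod_cast hd0
  haveI : (W.quadraticTwist (d : ℚ)).IsElliptic := W.isElliptic_quadraticTwist hD0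
  haveI : (W.baseChange ℚ_[ℓ]).IsElliptic := inferInstanceAs (W.map (algebraMap ℚ ℚ_[ℓ])).IsElliptic
  haveI : (Wd.baseChange ℚ_[ℓ]).IsElliptic := inferInstanceAs (Wd.map (algebraMap ℚ ℚ_[ℓ])).IsElliptic
  haveI := finite_residueField_padicInt ℓ
  set u : ℤ_[ℓ]ˣ := (X11b.isUnit_intCast_padicInt_of_not_dvd hℓd).unit with hu_def
  have hu : (u : ℤ_[ℓ]) = (d : ℤ_[ℓ]) := rfl
  have hu' : algebraMap ℤ_[ℓ] ℚ_[ℓ] (u : ℤ_[ℓ]) = algebraMap ℚ ℚ_[ℓ] (d : ℚ) := by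
    rw [hu]; simp
  have hnsq : ¬ IsSquare (IsLocalRing.residue ℤ_[ℓ] (u : ℤ_[ℓ])) := by
    rw [hu]; exact X11b.not_isSquare_residue_of_jacobiSym_eq_neg_one hJ
  set X : WeierstrassCurve ℚ_[ℓ] := W.baseChange ℚ_[ℓ] with hX
  set Y : WeierstrassCurve ℚ_[ℓ] := Wd.baseChange ℚ_[ℓ] with hY
  haveI hXmin : X.IsMinimal ℤ_[ℓ] := isMinimal_map_padic_of_isGloballyMinimal W ℓ
  haveI hYmin : Y.IsMinimal ℤ_[ℓ] := isMinimal_map_padic_of_isGloballyMinimal Wd ℓ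
  set Y' : WeierstrassCurve ℚ_[ℓ] := X.quadraticTwist (algebraMap ℤ_[ℓ] ℚ_[ℓ] (u : ℤ_[ℓ])) with hY'
  haveI hY'min : Y'.IsMinimal ℤ_[ℓ] :=
    isMinimal_quadraticTwist ℤ_[ℓ] X (X11b.isUnit_two_padicInt hℓ2) u
  have hX0 : X.Δ ≠ 0 := by
    rw [hX, baseChange, map_Δ, ← cast_minimalDiscriminantInt W, map_intCast]
    exact_mod_cast minimalDiscriminantInt_ne_zero W
  have hY'0 : Y'.Δ ≠ 0 := by
    rw [hY', quadraticTwist_Δ]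
    exact mul_ne_zero (pow_ne_zero 6 (by rw [hu']; exact (map_ne_zero _).mpr hD0)) hX0
  -- `Y = Cd • Y'`
  have hYY' : Y = Cd.map (algebraMap ℚ ℚ_[ℓ]) • Y' := by
    rw [hY, ← hWd, WeierstrassCurve.VariableChange.baseChange_smul_eq (W.quadraticTwist (d : ℚ)) Cd
      ℚ_[ℓ], baseChange, map_quadraticTwist, ← hu', hY', hX, baseChange]
  -- the chosen minimal models
  obtain ⟨C₁, hC₁⟩ : ∃ C : VariableChange ℚ_[ℓ], X.minimal ℤ_[ℓ] = C • X := ⟨_, rfl⟩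
  obtain ⟨C₂, hC₂⟩ : ∃ C : VariableChange ℚ_[ℓ], Y.minimal ℤ_[ℓ] = C • Y := ⟨_, rfl⟩
  have hC₂' : Y.minimal ℤ_[ℓ] = (C₂ * Cd.map (algebraMap ℚ ℚ_[ℓ])) • Y' := by
    rw [hC₂, hYY', mul_smul]
  -- `X` is multiplicative; the twist criterion
  have hXmult : X.HasMultiplicativeReduction ℤ_[ℓ] :=
    (hasMultiplicativeReduction_iff_of_isMinimal_of_eq_smul ℤ_[ℓ] hC₁ hX0).mp hmult
  have hsplit : Y'.HasSplitMultiplicativeReduction ℤ_[ℓ] ↔ ¬ X.HasSplitMultiplicativeReduction ℤ_[ℓ] := by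
    rw [hasSplitMultiplicativeReduction_quadraticTwist_iff ℤ_[ℓ] (X11b.isUnit_two_padicInt hℓ2) hXmult]
    constructor
    · intro h hXs; exact hnsq (h.mpr hXs)
    · intro h; exact ⟨fun hs ↦ absurd hs hnsq, fun hs ↦ absurd hs h⟩
  have hXs_iff : W.HasSplitMultiplicativeReductionAtPrime ℓ ↔ X.HasSplitMultiplicativeReduction ℤ_[ℓ] :=
    hasSplitMultiplicativeReduction_iff_of_isMinimal_of_eq_smul ℤ_[ℓ] hC₁ hX0
  have hYs_iff : Wd.HasSplitMultiplicativeReductionAtPrime ℓ ↔ Y'.HasSplitMultiplicativeReduction ℤ_[ℓ] :=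
    hasSplitMultiplicativeReduction_iff_of_isMinimal_of_eq_smul ℤ_[ℓ] hC₂' hY'0
  -- the place of `ℤ` above `ℓ`
  obtain ⟨v, hv⟩ : ∃ v : HeightOneSpectrum ℤ, (primesEquiv v : ℕ) = ℓ :=
    ⟨primesEquiv.symm ⟨ℓ, Fact.out⟩, by rw [Equiv.apply_symm_apply]⟩
  have hΔ : padicValInt ℓ Wd.minimalDiscriminantInt = padicValInt ℓ W.minimalDiscriminantInt :=
    X11b.padicValInt_minimalDiscriminantInt_twist_eq_of_jacobiSym W K Cd hWd ℓ hℓ2 hJ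
  by_cases hXs : X.HasSplitMultiplicativeReduction ℤ_[ℓ]
  · -- `W` split at `ℓ`: `c_ℓ(W) = ord_ℓ Δ_min(W)`
    have hWs : W.HasSplitMultiplicativeReductionAtPrime ℓ := hXs_iff.mpr hXs
    rw [X11b.localTamagawaNumber_eq_padicValInt_of_split W v hv hWs]
    exact Nat.le_add_right _ _
  · -- `Wd` split at `ℓ`: `c_ℓ(Wd) = ord_ℓ Δ_min(Wd) = ord_ℓ Δ_min(W)`
    have hWds : Wd.HasSplitMultiplicativeReductionAtPrime ℓ := hYs_iff.mpr (hsplit.mpr hXs)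
    rw [X11b.localTamagawaNumber_eq_padicValInt_of_split Wd v hv hWds, hΔ]
    exact Nat.le_add_left _ _

/-- **The same at `ℓ = 2` inert (`d_K ≡ 5 mod 8`)**: one of `E`, `E^{(d_K)}` is split multiplicative at
`2` with `c_2 = ord_2 Δ_min(E)` (`X11b.twist_two_of_mod_eight`), so
`ord_p(ord_2 Δ_min E) ≤ ord_p c_2(E) + ord_p c_2(E^{(d_K)})`.
[cite: SilvermanATAEC1994, Cor. IV.9.2(d) with (b) (PDF p. 340)] [cite: SilvermanAEC2009, VII.5 Prop. 5.1(b) and App. A Prop. A.1.1] -/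
theorem padicValNat_ordDisc_le_localTamagawaNumber_add_twist_of_inert_two (W : WeierstrassCurve ℚ)
    [W.IsElliptic] [W.IsGloballyMinimal] (K : Type) [Field K] [NumberField K]
    {Wd : WeierstrassCurve ℚ} [Wd.IsElliptic] [Wd.IsGloballyMinimal] (Cd : VariableChange ℚ)
    (hWd : Cd • W.quadraticTwist (NumberField.discr K : ℚ) = Wd) (h8 : NumberField.discr K % 8 = 5)
    (p : ℕ) [Fact p.Prime] (hmult : Mult W 2) :
    padicValNat p (padicValInt 2 W.minimalDiscriminantInt) ≤
      padicValNat p ((W.baseChange ℚ_[2]).localTamagawaNumber ℤ_[2]) +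
        padicValNat p ((Wd.baseChange ℚ_[2]).localTamagawaNumber ℤ_[2]) := by
  haveI : (W.baseChange ℚ_[2]).IsElliptic := inferInstanceAs (W.map (algebraMap ℚ ℚ_[2])).IsElliptic
  haveI : (Wd.baseChange ℚ_[2]).IsElliptic := inferInstanceAs (Wd.map (algebraMap ℚ ℚ_[2])).IsElliptic
  obtain ⟨hΔ, h⟩ := X11b.twist_two_of_mod_eight W K Cd hWd h8
  obtain ⟨-, hswap⟩ := h hmult
  obtain ⟨v, hv⟩ : ∃ v : HeightOneSpectrum ℤ, (primesEquiv v : ℕ) = 2 :=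
    ⟨primesEquiv.symm ⟨2, Nat.prime_two⟩, by rw [Equiv.apply_symm_apply]⟩
  by_cases hWs : W.HasSplitMultiplicativeReductionAtPrime 2
  · rw [X11b.localTamagawaNumber_eq_padicValInt_of_split W v hv hWs]
    exact Nat.le_add_right _ _
  · have hWds : Wd.HasSplitMultiplicativeReductionAtPrime 2 := hswap.mpr hWs
    rw [X11b.localTamagawaNumber_eq_padicValInt_of_split Wd v hv hWds, hΔ]
    exact Nat.le_add_left _ _

/-! ### Summing over a set of inert multiplicative primes -/

/-- `ord_p` of a finite product of non-zero naturals is the sum of the `ord_p`. [folklore] -/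
private theorem padicValNat_finset_prod'' (p : ℕ) [Fact p.Prime] {ι : Type*} (s : Finset ι)
    (f : ι → ℕ) (hf : ∀ i ∈ s, f i ≠ 0) :
    padicValNat p (∏ i ∈ s, f i) = ∑ i ∈ s, padicValNat p (f i) := by
  induction s using Finset.induction_on with
  | empty => simp
  | insert a s ha ih =>
    rw [Finset.prod_insert ha, Finset.sum_insert ha,
      padicValNat.mul (hf a (Finset.mem_insert_self a s))
        (Finset.prod_ne_zero_iff.mpr fun i hi => hf i (Finset.mem_insert_of_mem hi)),
      ih fun i hi => hf i (Finset.mem_insert_of_mem hi)]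

/-- `t_E(ℓ) = ord_p(ord_ℓ Δ_min(E))` with `ord_ℓ Δ_min` read as the `ℓ`-adic valuation of the minimal
discriminant. [folklore] -/
theorem tamagawaExponent_eq_padicValNat_padicValInt (W : WeierstrassCurve ℚ) [W.IsElliptic]
    [W.IsGloballyMinimal] (p ℓ : ℕ) [hℓ : Fact ℓ.Prime] :
    tamagawaExponent W p ℓ = padicValNat p (padicValInt ℓ W.minimalDiscriminantInt) := by
  obtain ⟨v, hv⟩ : ∃ v : HeightOneSpectrum ℤ, (primesEquiv v : ℕ) = ℓ :=
    ⟨primesEquiv.symm ⟨ℓ, hℓ.out⟩, by rw [Equiv.apply_symm_apply]⟩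
  rw [tamagawaExponent_of_prime W p hℓ.out, ← X11b.ordMinimalDiscriminant_int_eq_padicValInt W v hv]
  have hvℓ : v = primesEquiv.symm ⟨ℓ, hℓ.out⟩ := by
    apply primesEquiv.injective
    rw [Equiv.apply_symm_apply]
    exact Subtype.ext hv
  rw [← hvℓ]

/-- **`Σ_{ℓ ∈ S} t_E(ℓ) ≤ ord_p ∏_ℓ c_ℓ(E) + ord_p ∏_ℓ c_ℓ(E^{(d_K)})` for a set `S` of inert
multiplicative primes** (each `ℓ ∈ S`: odd with `(d_K/ℓ) = −1`, or `ℓ = 2` with `d_K ≡ 5 (mod 8)`;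
and multiplicative for `E`): both Tamagawa products are products of `ℓ`-adic local Tamagawa numbers
over the bad places (`tamagawaProduct_eq_prod`); the places above `S` contribute at least `t_E(ℓ)`
each (`padicValNat_ordDisc_le_localTamagawaNumber_add_twist_of_inert{,_two}`), the others `≥ 0`.
For the definite data of `X7.ToricPeriodUnitData` with `S` = the primes of `N⁻` this is the
cancellation «`c_ℓ(E)c_ℓ(E^{D})` versus `c_w(E/K) = ord_ℓ Δ`» of Jetchev–Skinner–Wan §7.3.1 read as
an inequality. [cite: JetchevSkinnerWan2017, §7.3.1 (eq:tamK) and §7.4.2 (p. 31)]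
[cite: SilvermanATAEC1994, Cor. IV.9.2(d) with (b) (PDF p. 340)] -/
theorem sum_tamagawaExponent_le_padicValNat_tamagawaProduct_add_twist (W : WeierstrassCurve ℚ)
    [W.IsElliptic] [W.IsGloballyMinimal] (p : ℕ) [Fact p.Prime] (K : Type) [Field K] [NumberField K]
    {Wd : WeierstrassCurve ℚ} [Wd.IsElliptic] [Wd.IsGloballyMinimal] (Cd : VariableChange ℚ)
    (hWd : Cd • W.quadraticTwist (NumberField.discr K : ℚ) = Wd) (S : Finset ℕ)
    (hS : ∀ ℓ ∈ S, ∃ _ : Fact ℓ.Prime, Mult W ℓ ∧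
      ((ℓ ≠ 2 ∧ jacobiSym (NumberField.discr K) ℓ = -1) ∨ (ℓ = 2 ∧ NumberField.discr K % 8 = 5))) :
    ∑ ℓ ∈ S, tamagawaExponent W p ℓ ≤
      padicValNat p W.tamagawaProduct + padicValNat p Wd.tamagawaProduct := by
  -- the union of the bad places of `W` and `Wd`
  have hfW : (W.badPlaces ℤ).Finite := W.finite_badPlaces_holds ℤ
  have hfWd : (Wd.badPlaces ℤ).Finite := Wd.finite_badPlaces_holds ℤ
  set s : Finset (HeightOneSpectrum ℤ) := hfW.toFinset ∪ hfWd.toFinset with hs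
  have hsW : ∀ v, ¬ W.HasGoodReductionAt v → v ∈ s := fun v hv ↦
    Finset.mem_union_left _ (by rw [Set.Finite.mem_toFinset, mem_badPlaces_iff]; exact hv)
  have hsWd : ∀ v, ¬ Wd.HasGoodReductionAt v → v ∈ s := fun v hv ↦
    Finset.mem_union_right _ (by rw [Set.Finite.mem_toFinset, mem_badPlaces_iff]; exact hv)
  -- local exponents
  set f : HeightOneSpectrum ℤ → ℕ := fun v ↦
    haveI := Fact.mk (primesEquiv v).2
    padicValNat p ((W.baseChange ℚ_[primesEquiv v]).localTamagawaNumber ℤ_[primesEquiv v]) +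
      padicValNat p ((Wd.baseChange ℚ_[primesEquiv v]).localTamagawaNumber ℤ_[primesEquiv v]) with hf
  set g : ℕ → ℕ := fun ℓ ↦ padicValNat p (padicValInt ℓ W.minimalDiscriminantInt) with hg
  -- termwise bound: `g ℓ_v ≤ f v` if `ℓ_v ∈ S`
  have hterm : ∀ v : HeightOneSpectrum ℤ,
      (if (primesEquiv v : ℕ) ∈ S then g (primesEquiv v : ℕ) else 0) ≤ f v := by
    intro v
    haveI := Fact.mk (primesEquiv v).2
    have key : ∀ (q : ℕ) (hq : Fact q.Prime), (primesEquiv v : ℕ) = q →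
        (if q ∈ S then g q else 0) ≤
        padicValNat p (@WeierstrassCurve.localTamagawaNumber ℤ_[q] _ _ _ ℚ_[q] _ _ _ (W.baseChange ℚ_[q])) +
          padicValNat p (@WeierstrassCurve.localTamagawaNumber ℤ_[q] _ _ _ ℚ_[q] _ _ _ (Wd.baseChange ℚ_[q])) := by
      rintro q hq hvq
      by_cases hqS : q ∈ S
      · obtain ⟨_, hmult, hcase⟩ := hS q hqS
        rw [if_pos hqS, hg]
        rcases hcase with ⟨hq2, hJ⟩ | ⟨rfl, h8⟩
        · exact padicValNat_ordDisc_le_localTamagawaNumber_add_twist_of_inert W K Cd hWd q hq2 hJ p hmult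
        · exact padicValNat_ordDisc_le_localTamagawaNumber_add_twist_of_inert_two W K Cd hWd h8 p hmult
      · rw [if_neg hqS]; exact Nat.zero_le _
    exact key _ _ rfl
  -- every `ℓ ∈ S` is the prime of a bad place of `W`
  have hSsub : S ⊆ (s.image fun v ↦ (primesEquiv v : ℕ)).filter (· ∈ S) := by
    intro ℓ hℓ
    obtain ⟨hℓP, hmult, -⟩ := hS ℓ hℓ
    refine Finset.mem_filter.mpr ⟨Finset.mem_image.mpr ⟨primesEquiv.symm ⟨ℓ, hℓP.out⟩, ?_, ?_⟩, hℓ⟩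
    · refine hsW _ fun hgood ↦ ?_
      have hgood' : W.HasGoodReductionAtPrime ℓ :=
        (W.hasGoodReductionAtPrime_iff_hasGoodReductionAt_holds ⟨ℓ, hℓP.out⟩).mpr hgood
      exact WeierstrassCurve.HasGoodReduction.not_hasMultiplicativeReduction (R := ℤ_[ℓ]) hgood' hmult
    · rw [Equiv.apply_symm_apply]
  -- sum over the places
  rw [tamagawaProduct_eq_prod W s hsW, tamagawaProduct_eq_prod Wd s hsWd,
    padicValNat_finset_prod'' p s _ fun v _ ↦ ?_, padicValNat_finset_prod'' p s _ fun v _ ↦ ?_,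
    ← Finset.sum_add_distrib]
  · calc ∑ ℓ ∈ S, tamagawaExponent W p ℓ
        = ∑ ℓ ∈ S, g ℓ := Finset.sum_congr rfl fun ℓ hℓ ↦ by
            obtain ⟨hℓP, -, -⟩ := hS ℓ hℓ
            exact tamagawaExponent_eq_padicValNat_padicValInt W p ℓ
      _ ≤ ∑ ℓ ∈ (s.image fun v ↦ (primesEquiv v : ℕ)).filter (· ∈ S), g ℓ :=
          Finset.sum_le_sum_of_subset_of_nonneg hSsub fun _ _ _ ↦ Nat.zero_le _
      _ = ∑ ℓ ∈ s.image (fun v ↦ (primesEquiv v : ℕ)), (if ℓ ∈ S then g ℓ else 0) := by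
          rw [Finset.sum_filter]
      _ = ∑ v ∈ s, (if (primesEquiv v : ℕ) ∈ S then g (primesEquiv v : ℕ) else 0) := by
          rw [Finset.sum_image]
          intro v _ w _ h
          exact primesEquiv.injective (Subtype.ext h)
      _ ≤ ∑ v ∈ s, f v := Finset.sum_le_sum fun v _ ↦ hterm v
  · haveI := Fact.mk (primesEquiv v).2
    haveI : (W.baseChange ℚ_[primesEquiv v]).IsElliptic :=
      inferInstanceAs (W.map (algebraMap ℚ ℚ_[primesEquiv v])).IsElliptic
    exact localTamagawaNumber_padic_ne_zero_holds (primesEquiv v) _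
  · haveI := Fact.mk (primesEquiv v).2
    haveI : (Wd.baseChange ℚ_[primesEquiv v]).IsElliptic :=
      inferInstanceAs (Wd.map (algebraMap ℚ ℚ_[primesEquiv v])).IsElliptic
    exact localTamagawaNumber_padic_ne_zero_holds (primesEquiv v) _

/-! ### The consumer without a Tamagawa hypothesis on `E` -/

/-- **Two UPPER halves close both pairs — NO Tamagawa hypothesis on `E`.** In the situation of
`X7.padicVal_sha_add_eq_of_toricPeriodUnitData` (data `hD`, optimal `Dt` with `p ∤ c(Dt)`, `p ≥ 5` good,
`ρ̄` onto, `r_an = 0`, `Wd = Cd • E^{(d_K)}` globally minimal; published facts by name), suppose the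
primes of `N⁻` are presented as inert multiplicative primes (`hS`: each `ℓ ∣ N⁻` is multiplicative for
`E` and either odd with `(d_K/ℓ) = −1` or `= 2` with `d_K ≡ 5 (mod 8)` — decidable per pair; class-wide
this is `ℓ ∣ N⁻` read through `GrossWaldspurgerCondition`, `(d_K, N) = 1` and the decomposition law
`ncard_primesOver_eq_two_iff_jacobiSym`), and the UPPER halves hold at `E` and at `Wd`. Then
`BSD(E,p) ∧ BSD(Wd,p)`: the exact identity gives
`(ord q − ord #Ш(E)) + (ord qd − ord #Ш(Wd)) = Σ_{ℓ∣N⁻} t_E(ℓ) − ord_p ∏c(E) − ord_p ∏c(Wd) ≤ 0`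
(`sum_tamagawaExponent_le_padicValNat_tamagawaProduct_add_twist`; torsion prime to `p` by
irreducibility), and both brackets are `≥ 0`. In particular `p ∤ ∏c(E)` is a CONSEQUENCE off `N⁻`, not a
hypothesis (and the data fields `ramified`, `tamagawa_twist` are not used).
[cite: Kim2024, Thm. 5.23] [cite: JetchevSkinnerWan2017, §7.3.1 (eq:tamK)] [cite: Miller2011LMS, §1 and Def. 1.1] -/
theorem X7.bsdp_and_bsdp_twist_of_toricPeriodUnitData_of_inert
    (W : WeierstrassCurve ℚ) [W.IsElliptic] [W.IsGloballyMinimal] [NeZero (W.conductorNorm ℤ)]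
    (p : ℕ) [Fact p.Prime] (K : Type) [Field K] [NumberField K] {Nplus Nminus : ℕ} (n : ℕ)
    (S₁ : Brandt.XiSetup Nplus Nminus) [Fintype (Brandt.ClassSet S₁.O)]
    (Sₙ : Brandt.XiSetup Nplus (Nminus * n)) [Fintype (Brandt.ClassSet Sₙ.O)]
    (ψ₁ : K →ₐ[ℚ] S₁.D) (ψₙ : K →ₐ[ℚ] Sₙ.D) (φ₁ f₁ : Brandt.ClassSet S₁.O → ℤ) (c : ℤ)
    (fₙ : Brandt.ClassSet Sₙ.O → ZMod p)
    (hD : X7.ToricPeriodUnitData W p K n S₁ Sₙ ψ₁ ψₙ φ₁ f₁ c fₙ)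
    (Dt : ModularParametrizationData W (W.conductorNorm ℤ))
    (hopt : ∀ (W' : WeierstrassCurve ℚ) [W'.IsElliptic]
      (D' : ModularParametrizationData W' (W.conductorNorm ℤ)), D'.f = Dt.f → Dt.modularDegree ≤ D'.modularDegree)
    (hKim : thm523_natCard_selmerGroupPInfty_eq_pow_of_unitToricPeriod)
    (hCST : thm12_trivialChar) (hZ : WZhang2014.thm64_padicValNat_congruenceNumber_eq)
    (hARS : padicValNat_congruenceNumber_eq_of_not_sq_dvd)
    (hGZK : rank_eq_analyticRank_of_analyticRank_le_one) (hmod : hasEntireLFunction_rat)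
    (hp5 : 5 ≤ p) (hgood : W.HasGoodReductionAtPrime p) (hsurj : W.HasSurjectiveModNGaloisRep (p : ℤ))
    (hc : ¬ (p : ℤ) ∣ Dt.c) (hr : W.analyticRank = 0)
    (hS : ∀ ℓ ∈ Nminus.primeFactors, ∃ _ : Fact ℓ.Prime, Mult W ℓ ∧
      ((ℓ ≠ 2 ∧ jacobiSym (NumberField.discr K) ℓ = -1) ∨ (ℓ = 2 ∧ NumberField.discr K % 8 = 5)))
    (Wd : WeierstrassCurve ℚ) [Wd.IsElliptic] [Wd.IsGloballyMinimal] (Cd : VariableChange ℚ)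
    (hWd : Cd • W.quadraticTwist (NumberField.discr K : ℚ) = Wd)
    (hupW : MissingUpperBoundAt W p) (hupd : MissingUpperBoundAt Wd p) :
    BSDp W p ∧ BSDp Wd p := by
  have hpp : p.Prime := Fact.out
  obtain ⟨q, hq, hleW⟩ := hupW
  obtain ⟨hfinW, hfind, qd, hqd, hval⟩ := X7.padicVal_sha_add_eq_of_toricPeriodUnitData W p K n S₁ Sₙ
    ψ₁ ψₙ φ₁ f₁ c fₙ hD Dt hopt hKim hCST hZ hARS hGZK hmod hp5 hgood hsurj hc hr q hq Wd Cd hWd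
  obtain ⟨qd', hqd', hled⟩ := hupd
  have hqq : qd' = qd := by exact_mod_cast hqd'.symm.trans hqd
  rw [hqq] at hled
  -- the Tamagawa inequality at the primes of `N⁻`
  have hT := sum_tamagawaExponent_le_padicValNat_tamagawaProduct_add_twist W p K Cd hWd
    Nminus.primeFactors hS
  -- torsion prime to `p`
  have hD0 : (NumberField.discr K : ℚ) ≠ 0 := by exact_mod_cast NumberField.discr_ne_zero K
  haveI : NeZero (p : ℚ) := ⟨by exact_mod_cast hpp.ne_zero⟩
  haveI hEt : (W.quadraticTwist (NumberField.discr K : ℚ)).IsElliptic := W.isElliptic_quadraticTwist hD0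
  have hsurjd : Wd.HasSurjectiveModNGaloisRep (p : ℤ) := by
    rw [← hWd]
    exact Summit.BirchSwinnertonDyer.BirchSwinnertonDyer.Theorems.twistAdmissible_hasSurjectiveModNGaloisRep_smul_quadraticTwist
      W hD0 Cd p hsurj
  have htW : padicValNat p W.torsionOrder = 0 := padicValNat_torsionOrder_eq_zero_of_irreducible W p
    (hasIrreducibleModPGaloisRep_of_hasSurjectiveModNGaloisRep W p hsurj)
  have htd : padicValNat p Wd.torsionOrder = 0 := padicValNat_torsionOrder_eq_zero_of_irreducible Wd p
    (hasIrreducibleModPGaloisRep_of_hasSurjectiveModNGaloisRep Wd p hsurjd)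
  rw [htW, htd] at hval
  simp only [Nat.cast_zero, mul_zero, add_zero] at hval
  have hT' : ((∑ ℓ ∈ Nminus.primeFactors, tamagawaExponent W p ℓ : ℕ) : ℤ) ≤
      (padicValNat p W.tamagawaProduct : ℤ) + (padicValNat p Wd.tamagawaProduct : ℤ) := by
    exact_mod_cast hT
  have heqW : padicValRat p q = padicValNat p W.shaOrder := by linarith
  have heqd : padicValRat p qd = padicValNat p Wd.shaOrder := by linarith
  have hrd : Wd.analyticRank = 0 := by
    rw [← hWd, analyticRank_smul]; exact hD.analyticRank_twist
  exact ⟨bsdp_of_missingPPartAt W p hGZK (by rw [hr]; exact Nat.zero_le _) ⟨q, hq, heqW⟩,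
    bsdp_of_missingPPartAt Wd p hGZK (by rw [hrd]; exact Nat.zero_le _) ⟨qd, hqd, heqd⟩⟩

end Summit.BirchSwinnertonDyer.Rank1Residual.Supersingular

end
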